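import Summits.QuantumAdvantage.QuantumAdvantage.Theorems.WalkThreeStepRegister
import Summits.QuantumAdvantage.QuantumAdvantage.Theorems.WalkThreeStepZoneFlip

/-!
# Rung (G♯₂) `ThreeStepFreeRungFive` (item stmt-QuantumAdvantage-23286), architecture (U), module U-d 3/5: DEGENERACY ⇒ the
# register is SYMMETRIC (ROUND-27 §3.5–3.6, step 1)

Cell qa-qnc0, route OddPrimeWalk, support item stmt-QuantumAdvantage-23286 (planner qa-qnc0-p2 g27); prover qn-prover-3 g16.

**`reg_cornerFlip`**: if every cut is R-local or block-blind for `[a, a+L)` (`LocalOrBlind`, 2/5) and every position of `[a, a+L)`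
is `Degenerate`, then for `a + 1 ≤ k < a + L` the transposition at `k` fixes the F₄ register (1/5): `reg S (cornerFlip n k x) = reg S x`
for EVERY input `x` (room `a + L + 2R + 4(2p−1) ≤ n`, `3 ∤ p`).
Proof: the register differential `D = Ŵ(x) + Ŵ(σ_k x)` only involves the own cut and the R-local cuts within `R` of `k`, so it is
unchanged by any modification above `max(k + 2R, a + L)` keeping `W mod p` and the residues of the own cut's two reads (`diff_congr`);
a zone flip in a clean far zone is such a modification and moves `W` by `±p`; two disjoint clean zones realise all residues of
`W mod 3`; degeneracy gives `Tr(ζ^{c+W'} D) = 0` for the four variants (`evZ_diff_of_degenerate`) and trace injectivity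
(`eq_zero_of_four_traces`, `decide`) gives `D = 0`.
WHAT THIS IS NOT: not the three-weights law yet (5/5); separation NOT moved.
-/

namespace Summit.QuantumAdvantage.AdviceFreeQNC0.LocalEngine

open Finset Classical

namespace RungU

variable {p n : ℕ}

/-! ### §3 The register differential of a transposition and its invariance under far modifications -/

/-- the differential `D_k(x) = Ŵ(x) + Ŵ(σ_k x)`. -/
noncomputable def diff (S : ThreeStep p n) (k : ℕ) (x : Fin n → Bool) : F4 := reg S x + reg S (cornerFlip n k x)

/-- a transposition inside `[a, a+L)` leaves the outside bits alone. -/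
theorem cornerFlip_agree_outside (k a L : ℕ) (hk1 : a + 1 ≤ k) (hk2 : k < a + L) (x : Fin n → Bool) (i : Fin n)
    (hi : ¬ (a ≤ i.val ∧ i.val < a + L)) : cornerFlip n k x i = x i :=
  DensePeel.cornerFlip_apply_of_ne k x i (by omega) (by omega)

/-- a transposition outside the window of an R-local cut leaves its window alone. -/
theorem cornerFlip_agree_window (k R : ℕ) (g : Fin (n + 1)) (hfar : ¬ (g.val ≤ k + R ∧ k ≤ g.val + R))
    (x : Fin n → Bool) (i : Fin n) (h1 : g.val ≤ i.val + R) (h2 : i.val < g.val + R) : cornerFlip n k x i = x i :=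
  DensePeel.cornerFlip_apply_of_ne k x i (by omega) (by omega)

/-- **Invariance of the differential**: if `x'` agrees with `x` below `z ≥ max(k + 2R, a + L)`, has the same weight `mod p`, and the two
reads of the own cut keep their residues `mod p`, then `D_k(x') = D_k(x)` (`a + 1 ≤ k < a + L`, every cut R-local or block-blind). -/
theorem diff_congr (S : ThreeStep p n) {a L R k z : ℕ} (hLB : LocalOrBlind S a L R) (hk1 : a + 1 ≤ k) (hk2 : k < a + L)
    (hkn : k < n) (hz1 : k + 2 * R ≤ z) (hz2 : a + L ≤ z) {x x' : Fin n → Bool}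
    (hag : ∀ i : Fin n, i.val < z → x' i = x i) (hwt : wt x' % p = wt x % p)
    (hr1 : wtPrefix x' (S.s ⟨k, by omega⟩) % p = wtPrefix x (S.s ⟨k, by omega⟩) % p)
    (hr2 : wtPrefix x' (max (S.s ⟨k, by omega⟩) (S.t ⟨k, by omega⟩)) % p
      = wtPrefix x (max (S.s ⟨k, by omega⟩) (S.t ⟨k, by omega⟩)) % p) :
    diff S k x' = diff S k x := by
  unfold diff reg
  rw [← Finset.sum_add_distrib, ← Finset.sum_add_distrib]
  apply Finset.sum_congr rfl
  intro g _
  -- prefix counts below z agree, also after the flip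
  have hagσ : ∀ i : Fin n, i.val < z → cornerFlip n k x' i = cornerFlip n k x i := by
    intro i hi
    by_cases h1 : i.val + 1 = k
    · have e : i = ⟨k - 1, by omega⟩ := Fin.ext (by simp; omega)
      rw [e, cornerFlip_apply_left k x' (by omega) hkn, cornerFlip_apply_left k x (by omega) hkn]
      exact hag _ (by simp; omega)
    · by_cases h2 : i.val = k
      · have e : i = ⟨k, hkn⟩ := Fin.ext (by simpa using h2)
        rw [e, cornerFlip_apply_right k x' (by omega) hkn, cornerFlip_apply_right k x (by omega) hkn]
        exact hag _ (by simp; omega)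
      · rw [DensePeel.cornerFlip_apply_of_ne k x' i h1 h2, DensePeel.cornerFlip_apply_of_ne k x i h1 h2]
        exact hag i hi
  have hNb : ∀ r, r ≤ z → wtPrefix x' r = wtPrefix x r := fun r hr =>
    DensePeel.wtPrefix_congr_below x' x r fun i hi => hag i (by omega)
  have hNbσ : ∀ r, r ≤ z → wtPrefix (cornerFlip n k x') r = wtPrefix (cornerFlip n k x) r := fun r hr =>
    DensePeel.wtPrefix_congr_below _ _ r fun i hi => hagσ i (by omega)
  by_cases hgk : g.val = k
  · -- the own cut: fire bits by the residue lemma, labels below z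
    have hg : g = ⟨k, by omega⟩ := Fin.ext hgk
    have hJ : S.y g x' = S.y g x := by
      rw [hg]
      exact y_congr_of_mod S _ hr1 hr2 hwt
    have hJσ : S.y g (cornerFlip n k x') = S.y g (cornerFlip n k x) := by
      rw [hg]
      apply y_congr_of_mod S
      · by_cases hs : S.s ⟨k, by omega⟩ = k
        · rw [hs, hNbσ k (by omega)]
        · rw [wtPrefix_cornerFlip k x' hs, wtPrefix_cornerFlip k x hs]; exact hr1
      · by_cases hs : max (S.s ⟨k, by omega⟩) (S.t ⟨k, by omega⟩) = k
        · rw [hs, hNbσ k (by omega)]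
        · rw [wtPrefix_cornerFlip k x' hs, wtPrefix_cornerFlip k x hs]; exact hr2
      · rw [wt_cornerFlip, wt_cornerFlip]; exact hwt
    rw [term_congr S g hJ (by rw [hgk]; exact hNb k (by omega)),
      term_congr S g hJσ (by rw [hgk]; exact hNbσ k (by omega))]
  · rcases hLB g with hloc | hbl
    · by_cases hnear : g.val ≤ k + R ∧ k ≤ g.val + R
      · -- near R-local cut: everything it sees lies below z
        have hJ : S.y g x' = S.y g x := hloc x' x (fun i h1 h2 => hag i (by omega)) hwt
        have hJσ : S.y g (cornerFlip n k x') = S.y g (cornerFlip n k x) :=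
          hloc _ _ (fun i h1 h2 => hagσ i (by omega)) (by rw [wt_cornerFlip, wt_cornerFlip]; exact hwt)
        rw [term_congr S g hJ (hNb g.val (by omega)), term_congr S g hJσ (hNbσ g.val (by omega))]
      · -- far R-local cut: its two terms cancel on both sides
        have h1 : term S (cornerFlip n k x') g = term S x' g :=
          term_congr S g (hloc _ _ (fun i hi1 hi2 => cornerFlip_agree_window k R g hnear x' i hi1 hi2) (by rw [wt_cornerFlip]))
            (wtPrefix_cornerFlip k x' hgk)
        have h2 : term S (cornerFlip n k x) g = term S x g :=
          term_congr S g (hloc _ _ (fun i hi1 hi2 => cornerFlip_agree_window k R g hnear x i hi1 hi2) (by rw [wt_cornerFlip]))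
            (wtPrefix_cornerFlip k x hgk)
        rw [h1, h2, F4_add_self, F4_add_self]
    · -- block-blind cut: its two terms cancel on both sides
      have h1 : term S (cornerFlip n k x') g = term S x' g :=
        term_congr S g (hbl _ _ (fun i hi => cornerFlip_agree_outside k a L hk1 hk2 x' i hi) (by rw [wt_cornerFlip]))
          (wtPrefix_cornerFlip k x' hgk)
      have h2 : term S (cornerFlip n k x) g = term S x g :=
        term_congr S g (hbl _ _ (fun i hi => cornerFlip_agree_outside k a L hk1 hk2 x i hi) (by rw [wt_cornerFlip]))
          (wtPrefix_cornerFlip k x hgk)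
      rw [h1, h2, F4_add_self, F4_add_self]

/-! ### §4 Degeneracy ⇒ symmetry of the register -/

/-- degeneracy at `k` in trace form: `Tr(ζ^{c+W} D_k(x)) = 0`. -/
theorem evZ_diff_of_degenerate (c : ℕ) (S : ThreeStep p n) (k : ℕ) (hdeg : Degenerate c S k) (x : Fin n → Bool) :
    evZ ((c + wt x : ℕ) : ZMod 3) (diff S k x) = 0 := by
  have h := hdeg x
  unfold discBit3 at h
  have e : ringWinU c S.y x = ringWinU c S.y (cornerFlip n k x) := by
    cases h1 : ringWinU c S.y x <;> cases h2 : ringWinU c S.y (cornerFlip n k x) <;> rw [h1, h2] at h <;> simp_all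
  unfold diff
  rw [evZ_map_add, ← win_toNat_eq_ev]
  have e2 : evZ ((c + wt x : ℕ) : ZMod 3) (reg S (cornerFlip n k x)) = (((ringWinU c S.y (cornerFlip n k x)).toNat : ℕ) : ZMod 2) := by
    rw [win_toNat_eq_ev, wt_cornerFlip]
  rw [e2, e]
  have : ∀ z : ZMod 2, z + z = 0 := by decide
  exact this _

/-- the four-trace lemma: `Tr(ζ^{t} y) = 0` for `t ∈ {t₀, t₀+s₁, t₀+s₂, t₀+s₁+s₂}` with `s₁, s₂ ≠ 0` forces `y = 0`. -/
theorem eq_zero_of_four_traces (t₀ s₁ s₂ : ZMod 3) (y : F4) (h1 : s₁ ≠ 0) (h2 : s₂ ≠ 0)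
    (e0 : evZ t₀ y = 0) (e1 : evZ (t₀ + s₁) y = 0) (e2 : evZ (t₀ + s₂) y = 0) (e3 : evZ (t₀ + s₁ + s₂) y = 0) : y = 0 := by
  revert t₀ s₁ s₂ y; decide

/-- `(p : ZMod 3) ≠ 0` when `3 ∤ p`. -/
theorem cast_p_ne_zero (hp3 : p % 3 ≠ 0) : ((p : ℕ) : ZMod 3) ≠ 0 := by
  rw [ne_eq, ZMod.natCast_eq_zero_iff, Nat.dvd_iff_mod_eq_zero]
  exact hp3

/-- **DEGENERACY ⇒ SYMMETRY** (ROUND-27 §3.6 step 1): on a degenerate interval with every cut R-local or block-blind, every transposition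
strictly inside the interval fixes the register of every input. -/
theorem reg_cornerFlip (hp : 1 ≤ p) (hp3 : p % 3 ≠ 0) (c : ℕ) (S : ThreeStep p n) {a L R : ℕ}
    (hLB : LocalOrBlind S a L R) (hdeg : ∀ k, a ≤ k → k < a + L → Degenerate c S k)
    (hn : a + L + 2 * R + 4 * (2 * p - 1) ≤ n) {k : ℕ} (hk1 : a + 1 ≤ k) (hk2 : k < a + L) (x : Fin n → Bool) :
    reg S (cornerFlip n k x) = reg S x := by
  have hkn : k < n := by omega
  set z₀ := a + L + 2 * R with hz₀
  set m := 2 * p - 1 with hm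
  have hm1 : 1 ≤ m := by omega
  -- two clean zones for the reads of the own cut
  obtain ⟨j₁, j₂, hj12, hj2, c11, c12, c21, c22⟩ :=
    exists_two_clean z₀ m (S.s ⟨k, by omega⟩) (max (S.s ⟨k, by omega⟩) (S.t ⟨k, by omega⟩))
  have hzone1 : z₀ + j₁ * m + m ≤ n := by nlinarith
  have hzone2 : z₀ + j₂ * m + m ≤ n := by nlinarith
  obtain ⟨F₁, hF₁⟩ := exists_zoneFlip hp x (z₀ + j₁ * m) (by rw [← hm]; exact hzone1)
  obtain ⟨F₂, hF₂⟩ := exists_zoneFlip hp (flipOn F₁ x) (z₀ + j₂ * m) (by rw [← hm]; exact hzone2)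
  -- F₂ sits above F₁'s zone, so flipping F₂ alone is also a zone flip of x
  have hsep : z₀ + j₁ * m + m ≤ z₀ + j₂ * m := by nlinarith
  have hF₂' : ZoneFlip p x F₂ (z₀ + j₂ * m) (2 * p - 1) := by
    refine ⟨hF₂.card_eq, hF₂.inside, ?_⟩
    have e : ∀ i ∈ F₂, flipOn F₁ x i = x i := by
      intro i hi
      apply flipOn_of_not_mem
      intro hi1
      have a1 := (hF₁.inside i hi1).2
      have a2 := (hF₂.inside i hi).1
      omega
    rcases hF₂.const with h | h
    · left; intro i hi; rw [← e i hi]; exact h i hi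
    · right; intro i hi; rw [← e i hi]; exact h i hi
  -- the differential is the same for x and the three flipped variants
  have hD : ∀ {y : Fin n → Bool} {F : Finset (Fin n)} {zz : ℕ}, ZoneFlip p y F zz (2 * p - 1) → z₀ ≤ zz → zz + (2 * p - 1) ≤ n →
      ¬ (zz < S.s ⟨k, by omega⟩ ∧ S.s ⟨k, by omega⟩ < zz + (2 * p - 1)) →
      ¬ (zz < max (S.s ⟨k, by omega⟩) (S.t ⟨k, by omega⟩) ∧ max (S.s ⟨k, by omega⟩) (S.t ⟨k, by omega⟩) < zz + (2 * p - 1)) →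
      diff S k (flipOn F y) = diff S k y := by
    intro y F zz hF hzz hzn cr1 cr2
    exact diff_congr S hLB hk1 hk2 hkn (z := z₀) (by omega) (by omega) (fun i hi => hF.apply_of_lt (by omega))
      (hF.wt_mod_eq hzn) (hF.wtPrefix_mod_eq cr1) (hF.wtPrefix_mod_eq cr2)
  have d1 : diff S k (flipOn F₁ x) = diff S k x :=
    hD hF₁ (by omega) (by rw [← hm]; exact hzone1) (by rw [← hm]; exact c11) (by rw [← hm]; exact c12)
  have d2 : diff S k (flipOn F₂ x) = diff S k x :=
    hD hF₂' (by omega) (by rw [← hm]; exact hzone2) (by rw [← hm]; exact c21) (by rw [← hm]; exact c22)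
  have d12 : diff S k (flipOn F₂ (flipOn F₁ x)) = diff S k x := by
    rw [hD hF₂ (by omega) (by rw [← hm]; exact hzone2) (by rw [← hm]; exact c21) (by rw [← hm]; exact c22), d1]
  -- the four traces vanish by degeneracy at k
  have hdk := hdeg k (by omega) hk2
  have t0 := evZ_diff_of_degenerate c S k hdk x
  have t1 := evZ_diff_of_degenerate c S k hdk (flipOn F₁ x)
  have t2 := evZ_diff_of_degenerate c S k hdk (flipOn F₂ x)
  have t12 := evZ_diff_of_degenerate c S k hdk (flipOn F₂ (flipOn F₁ x))
  rw [d1] at t1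
  rw [d2] at t2
  rw [d12] at t12
  -- weights of the variants in ZMod 3
  have hpz := cast_p_ne_zero hp3
  obtain ⟨s₁, hs₁, w1⟩ : ∃ s₁ : ZMod 3, s₁ ≠ 0 ∧ ((wt (flipOn F₁ x) : ℕ) : ZMod 3) = (wt x : ℕ) + s₁ := by
    rcases hF₁.wt_cast_three (by rw [← hm]; exact hzone1) with e | e
    · exact ⟨(p : ℕ), hpz, e⟩
    · exact ⟨-((p : ℕ) : ZMod 3), neg_ne_zero.mpr hpz, by rw [e]; ring⟩
  obtain ⟨s₂, hs₂, w2, w12⟩ : ∃ s₂ : ZMod 3, s₂ ≠ 0 ∧ ((wt (flipOn F₂ x) : ℕ) : ZMod 3) = (wt x : ℕ) + s₂ ∧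
      ((wt (flipOn F₂ (flipOn F₁ x)) : ℕ) : ZMod 3) = (wt (flipOn F₁ x) : ℕ) + s₂ := by
    -- both flips of F₂ move the weight in the same direction (same constant value on F₂)
    have hz2n : z₀ + j₂ * m + (2 * p - 1) ≤ n := by rw [← hm]; exact hzone2
    have eF : (F₂.filter fun i => i.val < n) = F₂ := Finset.filter_true_of_mem fun i _ => i.isLt
    rcases hF₂'.const with hc | hc
    · have hc' : ∀ i ∈ F₂, flipOn F₁ x i = false := by
        intro i hi
        rw [flipOn_of_not_mem]
        · exact hc i hi
        · intro hi1; have a1 := (hF₁.inside i hi1).2; have a2 := (hF₂.inside i hi).1; omega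
      refine ⟨(p : ℕ), hpz, ?_, ?_⟩
      · rw [Coset21.wt_eq_wtPrefix, Coset21.wt_eq_wtPrefix, wtPrefix_flipOn_false F₂ x hc n, eF, hF₂.card_eq, Nat.cast_add]
      · rw [Coset21.wt_eq_wtPrefix, Coset21.wt_eq_wtPrefix, wtPrefix_flipOn_false F₂ _ hc' n, eF, hF₂.card_eq, Nat.cast_add]
    · have hc' : ∀ i ∈ F₂, flipOn F₁ x i = true := by
        intro i hi
        rw [flipOn_of_not_mem]
        · exact hc i hi
        · intro hi1; have a1 := (hF₁.inside i hi1).2; have a2 := (hF₂.inside i hi).1; omega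
      refine ⟨-((p : ℕ) : ZMod 3), neg_ne_zero.mpr hpz, ?_, ?_⟩
      · have h := wtPrefix_flipOn_true F₂ x hc n
        rw [eF, hF₂.card_eq] at h
        rw [Coset21.wt_eq_wtPrefix, Coset21.wt_eq_wtPrefix, ← h, Nat.cast_add]; ring
      · have h := wtPrefix_flipOn_true F₂ _ hc' n
        rw [eF, hF₂.card_eq] at h
        rw [Coset21.wt_eq_wtPrefix, Coset21.wt_eq_wtPrefix, ← h, Nat.cast_add]; ring
  have e0 : ((c + wt (flipOn F₁ x) : ℕ) : ZMod 3) = ((c + wt x : ℕ) : ZMod 3) + s₁ := by push_cast; rw [w1]; ring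
  have e2' : ((c + wt (flipOn F₂ x) : ℕ) : ZMod 3) = ((c + wt x : ℕ) : ZMod 3) + s₂ := by push_cast; rw [w2]; ring
  have e12 : ((c + wt (flipOn F₂ (flipOn F₁ x)) : ℕ) : ZMod 3) = ((c + wt x : ℕ) : ZMod 3) + s₁ + s₂ := by
    push_cast; rw [w12, w1]; ring
  rw [e0] at t1
  rw [e2'] at t2
  rw [e12] at t12
  have hD0 := eq_zero_of_four_traces _ s₁ s₂ (diff S k x) hs₁ hs₂ t0 t1 t2 t12
  unfold diff at hD0
  have : ∀ a b : F4, a + b = 0 → b = a := by decide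
  exact this _ _ hD0


end RungU

end Summit.QuantumAdvantage.AdviceFreeQNC0.LocalEngine
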